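import Summits.KontsevichZagierPeriods.KontsevichZagierPeriods.Theorems.SoloBlindQuinticLinear
import HarnessLib

/-!
# The linear sector at every level: one Beta class per `S₃`-orbit spans `V_N`

Fix a level `N ≥ 2` and let `V_N ⊂ Q = (FormalRep ⧸ ⟨rules⟩) ⊗ K₀` be the `K₀`-span of `x_π` and
of all convergent Beta classes `[β(k/N + m, l/N + n)]`, `1 ≤ k, l ≤ N - 1`, `m, n ∈ ℕ`.
To a pair `(k, l)` with `k + l ≠ N` attach the exponent triple `(k, l, t)`, `t = N - k - l`
(first kind, `k + l < N`) or `t = 2N - k - l` (second kind, `k + l > N`).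

* `betaQ_propTo_third` (**the orbit move**): inside the three Kontsevich–Zagier rules,
  `[β(a,b)]` is a nonzero `K₀`-multiple of `[β(t,b)]`, `t` the third exponent — by the first-kind
  cyclic relation `sin(πa) β(a,1-a-b) = sin(πb) β(b,1-a-b)` (`SoloBlindCyclicBeta`) or the
  second-kind relation `(1-b) sin(πa) β(a,2-a-b) = (1-a) sin(πb) β(b,2-a-b)`
  (`SoloBlindSecondBeta`). With the symmetry `β(a,b) = β(b,a)` this generates the whole `S₃`-orbit
  of the triple (`propTo_of_sameOrbit`), and pairs with `k + l = N` are multiples of `x_π`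
  (reflection, `SoloBlindBetaReflection`).
* `levelSpan_le`: hence `V_N` is spanned by `x_π` and ONE Beta class per `S₃`-orbit, for any set
  `R` of orbit representatives (`Represents N R`, decidable — checked by `decide` at levels 5, 6, 7).
* `kz_levelLinear`: if the periods `π` and `B(k/N, l/N)`, `(k,l) ∈ R`, are linearly independent over
  `K₀ = ℚ̄ ∩ ℝ`, the period map `evalQ` is injective on `V_N` — every `K₀`-linear relation among
  level-`N` Beta words with vanishing period follows from the three rules.

For `N` prime (and `N = 4`) the `S₃`-orbits are exactly the Deligne–Koblitz–Ogus classes — the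
Koblitz–Ogus criterion `u ↦ ⟨uk/N⟩ + ⟨ul/N⟩ + ⟨ut/N⟩` separates the orbits; verified by exact
computation for all primes `N ≤ 131` — so the hypothesis is precisely the linear-independence
THEOREM of J. Wolfart and G. Wüstholz (Math. Ann. 273 (1985) 1–15): `kz_level5`, `kz_level7` are
unconditional modulo carrying that published theorem as a hypothesis. For composite levels with
Gauss-multiplication coincidences (`N = 6, 8, 9, 10, 12, …`) further classes merge
(e.g. `β(1/6,1/6) ∈ ℚ̄ β(1/6,1/3)` by duplication, `β(1/8,1/4) ∈ ℚ̄ β(1/4,1/4)`), the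
hypothesis of `kz_levelLinear` for a full set of orbit representatives is then false (so the
instance `kz_level6` below is vacuous — see `SoloBlindLevelSix` for the correct three-generator
statement at level `6`), and the missing in-rules relations are the subject of
`SoloBlindDuplication` and its sequels.
-/

noncomputable section

open Set

namespace Summit.KontsevichZagierPeriods.KontsevichZagierPeriods.Theorems

namespace SoloBlind

open Literature.NumberTheory.Transcendental
open Literature.NumberTheory.Transcendental.KZ

/-! ## Proportionality in `Q` -/

/-- `PropTo x y`: `x` is a NONZERO `K₀`-multiple of `y` in `Q`. -/
def PropTo (x y : Q) : Prop := ∃ c : K₀, c ≠ 0 ∧ x = c • y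

namespace PropTo

/-- Reflexivity. -/
theorem refl (x : Q) : PropTo x x := ⟨1, one_ne_zero, (one_smul _ _).symm⟩

/-- Symmetry. -/
theorem symm {x y : Q} (h : PropTo x y) : PropTo y x := by
  obtain ⟨c, hc, e⟩ := h
  exact ⟨c⁻¹, inv_ne_zero hc, by rw [e, inv_smul_smul₀ hc]⟩

/-- Transitivity. -/
theorem trans {x y z : Q} (h : PropTo x y) (h' : PropTo y z) : PropTo x z := by
  obtain ⟨c, hc, e⟩ := h
  obtain ⟨c', hc', e'⟩ := h'
  exact ⟨c * c', mul_ne_zero hc hc', by rw [e, e', mul_smul]⟩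

/-- A class proportional to a member of a subspace lies in it. -/
theorem mem {S : Submodule K₀ Q} {x y : Q} (h : PropTo x y) (hy : y ∈ S) : x ∈ S := by
  obtain ⟨c, -, e⟩ := h
  rw [e]
  exact S.smul_mem _ hy

/-- From `c • x = c' • y` with `c, c' ≠ 0`. -/
theorem of_smul_eq_smul {x y : Q} {c c' : K₀} (hc : c ≠ 0) (hc' : c' ≠ 0) (h : c • x = c' • y) :
    PropTo x y :=
  ⟨c⁻¹ * c', mul_ne_zero (inv_ne_zero hc) hc', by rw [mul_smul, ← h, inv_smul_smul₀ hc]⟩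

end PropTo

/-! ## The third exponent and the orbit move (rational form) -/

variable {a b : ℚ}

/-- The third exponent of the triple of `β(a,b)`: `1 - a - b` (first kind, `a + b < 1`) or
`2 - a - b` (second kind). -/
def thirdQ (a b : ℚ) : ℚ := if a + b < 1 then 1 - a - b else 2 - a - b

/-- `thirdQ` is symmetric. -/
theorem thirdQ_comm (a b : ℚ) : thirdQ a b = thirdQ b a := by
  unfold thirdQ; rw [add_comm]; split_ifs <;> ring

/-- `0 < t`. -/
theorem thirdQ_pos (ha1 : a < 1) (hb1 : b < 1) : 0 < thirdQ a b := by
  unfold thirdQ; split_ifs with h <;> linarith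

/-- `t < 1`. -/
theorem thirdQ_lt_one (ha : 0 < a) (hb : 0 < b) (hab : a + b ≠ 1) : thirdQ a b < 1 := by
  unfold thirdQ
  split_ifs with h
  · linarith
  · have h' : 1 < a + b := lt_of_le_of_ne (not_lt.mp h) (Ne.symm hab)
    linarith

/-- `a + t ≠ 1`. -/
theorem add_thirdQ_ne_one (a : ℚ) (hb : 0 < b) (hb1 : b < 1) : a + thirdQ a b ≠ 1 := by
  unfold thirdQ; split_ifs <;> intro h' <;> linarith

/-- The third exponent of `(a, t)` is `b` again. -/
theorem thirdQ_thirdQ (a : ℚ) (hb : 0 < b) (hb1 : b < 1) : thirdQ a (thirdQ a b) = b := by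
  by_cases h : a + b < 1
  · simp only [thirdQ, if_pos h]
    rw [if_pos (by linarith)]
    ring
  · simp only [thirdQ, if_neg h]
    rw [if_neg (by linarith)]
    ring

/-- **The orbit move**: `[β(a,b)]` is a nonzero `K₀`-multiple of `[β(t,b)]`, `t` the third
exponent — by the cyclic relation (first kind) or the second-kind relation. -/
theorem betaQ_propTo_third (ha : 0 < a) (ha1 : a < 1) (hb : 0 < b) (hb1 : b < 1)
    (hab : a + b ≠ 1) : PropTo (betaQ a b) (betaQ (thirdQ a b) b) := by
  by_cases h : a + b < 1
  · have ht : thirdQ a b = 1 - a - b := if_pos h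
    have h1 := betaQ_cyclic_rat a (1 - a - b) ha (by linarith) (by linarith)
    rw [show (1 : ℚ) - a - (1 - a - b) = b by ring] at h1
    rw [ht]
    exact PropTo.of_smul_eq_smul (sinQ_ne_zero ha ha1)
      (sinQ_ne_zero (by linarith) (by linarith)) h1
  · have h' : 1 < a + b := lt_of_le_of_ne (not_lt.mp h) (Ne.symm hab)
    have ht : thirdQ a b = 2 - a - b := if_neg h
    have h1 := betaQ_second_rat a (2 - a - b) ha1 (by linarith) (by linarith)
    rw [show (2 : ℚ) - a - (2 - a - b) = b by ring, smul_smul, smul_smul] at h1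
    rw [ht]
    have hq : ((1 - (2 - a - b) : ℚ) : K₀) ≠ 0 := by
      exact_mod_cast (show (1 - (2 - a - b) : ℚ) ≠ 0 by intro e; linarith)
    have hq' : ((1 - a : ℚ) : K₀) ≠ 0 := by
      exact_mod_cast (show (1 - a : ℚ) ≠ 0 by intro e; linarith)
    exact PropTo.of_smul_eq_smul (mul_ne_zero hq (sinQ_ne_zero ha ha1))
      (mul_ne_zero hq' (sinQ_ne_zero (by linarith) (by linarith))) h1

/-- Symmetry as a proportionality: `[β(b,a)] ≐ [β(a,b)]`. -/
theorem betaQ_propTo_symm (ha : 0 < a) (hb : 0 < b) : PropTo (betaQ b a) (betaQ a b) :=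
  ⟨1, one_ne_zero, by rw [one_smul, betaQ_symm ha hb]⟩

section orbit

variable (ha : 0 < a) (ha1 : a < 1) (hb : 0 < b) (hb1 : b < 1) (hab : a + b ≠ 1)
include ha ha1 hb hb1 hab

/-- Orbit element `(t, b)`. -/
theorem betaQ_propTo_tb : PropTo (betaQ (thirdQ a b) b) (betaQ a b) :=
  (betaQ_propTo_third ha ha1 hb hb1 hab).symm

/-- Orbit element `(b, t)`. -/
theorem betaQ_propTo_bt : PropTo (betaQ b (thirdQ a b)) (betaQ a b) :=
  (betaQ_propTo_symm (thirdQ_pos ha1 hb1) hb).trans (betaQ_propTo_tb ha ha1 hb hb1 hab)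

/-- Orbit element `(t, a)`. -/
theorem betaQ_propTo_ta : PropTo (betaQ (thirdQ a b) a) (betaQ a b) := by
  have h := betaQ_propTo_third hb hb1 ha ha1 (by rwa [add_comm])
  rw [← thirdQ_comm] at h
  exact h.symm.trans (betaQ_propTo_symm ha hb)

/-- Orbit element `(a, t)`. -/
theorem betaQ_propTo_at : PropTo (betaQ a (thirdQ a b)) (betaQ a b) :=
  (betaQ_propTo_symm (thirdQ_pos ha1 hb1) ha).trans (betaQ_propTo_ta ha ha1 hb hb1 hab)

end orbit

/-! ## Integer bookkeeping at level `N` -/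

/-- The level-`N` exponent pairs `(k, l)`, `1 ≤ k, l ≤ N - 1`, `k + l ≠ N` (the pairs with
`k + l = N` are reflection values, multiples of `x_π`). -/
def levelPairs (N : ℕ) : Finset (ℕ × ℕ) :=
  (Finset.Icc 1 (N - 1) ×ˢ Finset.Icc 1 (N - 1)).filter fun kl => kl.1 + kl.2 ≠ N

/-- The third exponent numerator: `N - k - l` (first kind) or `2N - k - l` (second kind). -/
def third (N k l : ℕ) : ℕ := if k + l < N then N - k - l else 2 * N - k - l

/-- The six arrangements `(k', l', t')` of the triple of `(k, l)`. -/
def orbitTriples (N k l : ℕ) : List (ℕ × ℕ × ℕ) :=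
  [(k, l, third N k l), (l, k, third N k l), (third N k l, l, k), (l, third N k l, k),
    (third N k l, k, l), (k, third N k l, l)]

/-- `SameOrbit N p q`: the triple of `q` is an arrangement of the triple of `p`. -/
def SameOrbit (N : ℕ) (p q : ℕ × ℕ) : Prop :=
  (q.1, q.2, third N q.1 q.2) ∈ orbitTriples N p.1 p.2

/-- `SameOrbit` is decidable (a membership test in a six-element list). -/
instance (N : ℕ) (p q : ℕ × ℕ) : Decidable (SameOrbit N p q) := by
  unfold SameOrbit; infer_instance

/-- `R` is a set of orbit representatives: `R ⊆ levelPairs N` meets every `S₃`-orbit. -/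
def Represents (N : ℕ) (R : Finset (ℕ × ℕ)) : Prop :=
  R ⊆ levelPairs N ∧ ∀ q ∈ levelPairs N, ∃ p ∈ R, SameOrbit N p q

/-- `Represents` is decidable, so concrete representative sets are checked by `decide`. -/
instance (N : ℕ) (R : Finset (ℕ × ℕ)) : Decidable (Represents N R) := by
  unfold Represents; infer_instance

/-- Membership in `levelPairs`. -/
theorem mem_levelPairs {N : ℕ} {kl : ℕ × ℕ} : kl ∈ levelPairs N ↔
    (1 ≤ kl.1 ∧ kl.1 ≤ N - 1) ∧ (1 ≤ kl.2 ∧ kl.2 ≤ N - 1) ∧ kl.1 + kl.2 ≠ N := by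
  simp only [levelPairs, Finset.mem_filter, Finset.mem_product, Finset.mem_Icc, and_assoc]

/-- The third exponent numerator over `N` is the rational third exponent. -/
theorem third_div_eq {N k l : ℕ} (hkN : k < N) (hlN : l < N) :
    ((third N k l : ℕ) : ℚ) / N = thirdQ ((k : ℚ) / N) ((l : ℚ) / N) := by
  have hN : (0 : ℚ) < N := by exact_mod_cast (show 0 < N by omega)
  unfold third thirdQ
  by_cases h : k + l < N
  · have hq : (k : ℚ) / N + l / N < 1 := by
      rw [← add_div, div_lt_one hN]; exact_mod_cast h
    have e : ((N - k - l : ℕ) : ℚ) = N - k - l := by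
      rw [Nat.sub_sub, Nat.cast_sub (by omega)]; push_cast; ring
    rw [if_pos h, if_pos hq, e]
    field_simp
  · have hq : ¬ ((k : ℚ) / N + l / N < 1) := by
      rw [← add_div, div_lt_one hN, not_lt]; exact_mod_cast (by omega : N ≤ k + l)
    have e : ((2 * N - k - l : ℕ) : ℚ) = 2 * N - k - l := by
      rw [Nat.sub_sub, Nat.cast_sub (by omega)]; push_cast; ring
    rw [if_neg h, if_neg hq, e]
    field_simp

/-- **Pairs in the same `S₃`-orbit have proportional Beta classes.** -/
theorem propTo_of_sameOrbit {N : ℕ} {p q : ℕ × ℕ} (hp : p ∈ levelPairs N)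
    (hq : q ∈ levelPairs N) (h : SameOrbit N p q) :
    PropTo (betaQ ((q.1 : ℚ) / N) ((q.2 : ℚ) / N)) (betaQ ((p.1 : ℚ) / N) ((p.2 : ℚ) / N)) := by
  obtain ⟨k, l⟩ := p
  obtain ⟨k', l'⟩ := q
  rw [mem_levelPairs] at hp hq
  obtain ⟨⟨hk, hkN⟩, ⟨hl, hlN⟩, hkl⟩ := hp
  have hN : (0 : ℚ) < N := by exact_mod_cast (show 0 < N by omega)
  have ha : (0 : ℚ) < k / N := div_pos (by exact_mod_cast hk) hN
  have hb : (0 : ℚ) < l / N := div_pos (by exact_mod_cast hl) hN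
  have ha1 : (k : ℚ) / N < 1 := by rw [div_lt_one hN]; exact_mod_cast (by omega : k < N)
  have hb1 : (l : ℚ) / N < 1 := by rw [div_lt_one hN]; exact_mod_cast (by omega : l < N)
  have hab : (k : ℚ) / N + l / N ≠ 1 := by
    rw [← add_div, Ne, div_eq_one_iff_eq hN.ne']; exact_mod_cast hkl
  have ht := third_div_eq (by omega : k < N) (by omega : l < N)
  simp only [SameOrbit, orbitTriples, List.mem_cons, List.not_mem_nil, Prod.mk.injEq,
    or_false] at h
  dsimp only
  rcases h with ⟨rfl, rfl, -⟩ | ⟨rfl, rfl, -⟩ | ⟨rfl, rfl, -⟩ | ⟨rfl, rfl, -⟩ |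
    ⟨rfl, rfl, -⟩ | ⟨rfl, rfl, -⟩
  · exact PropTo.refl _
  · exact betaQ_propTo_symm ha hb
  · rw [ht]; exact betaQ_propTo_tb ha ha1 hb hb1 hab
  · rw [ht]; exact betaQ_propTo_bt ha ha1 hb hb1 hab
  · rw [ht]; exact betaQ_propTo_ta ha ha1 hb hb1 hab
  · rw [ht]; exact betaQ_propTo_at ha ha1 hb hb1 hab

/-! ## The span `V_N` and its generators -/

/-- The generating family attached to a representative set `R`: `x_π` and `[β(k/N, l/N)]`,
`(k, l) ∈ R`. -/
def levelGens (N : ℕ) (R : Finset (ℕ × ℕ)) : Option ↥R → Q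
  | none => xPi
  | some r => betaQ ((r.1.1 : ℚ) / N) ((r.1.2 : ℚ) / N)

/-- The level-`N` linear sector `V_N`: the `K₀`-span of `x_π` and of all
`[β(k/N + m, l/N + n)]`, `1 ≤ k, l < N`, `m, n ∈ ℕ`. -/
def levelSpan (N : ℕ) : Submodule K₀ Q :=
  Submodule.span K₀ (insert xPi {x | ∃ k l m n : ℕ, 1 ≤ k ∧ k < N ∧ 1 ≤ l ∧ l < N ∧
    x = betaQ ((k : ℚ) / N + m) ((l : ℚ) / N + n)})

/-- Every level-`N` class `[β(k/N, l/N)]` lies in the span of the generators. -/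
theorem betaQ_level_mem {N : ℕ} (hN : 2 ≤ N) {R : Finset (ℕ × ℕ)} (hR : Represents N R)
    {k l : ℕ} (hk : 1 ≤ k) (hkN : k < N) (hl : 1 ≤ l) (hlN : l < N) :
    betaQ ((k : ℚ) / N) ((l : ℚ) / N) ∈ Submodule.span K₀ (range (levelGens N R)) := by
  have hN0 : (N : ℚ) ≠ 0 := by exact_mod_cast (show N ≠ 0 by omega)
  by_cases hkl : k + l = N
  · have e : (l : ℚ) / N = 1 - (k : ℚ) / N := by
      rw [eq_sub_iff_add_eq, ← add_div, div_eq_one_iff_eq hN0]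
      exact_mod_cast (by omega : l + k = N)
    rw [e, betaQ_reflection hk hkN]
    exact Submodule.smul_mem _ _ (Submodule.subset_span ⟨none, rfl⟩)
  · have hq : (k, l) ∈ levelPairs N := by
      rw [mem_levelPairs]; exact ⟨⟨hk, by omega⟩, ⟨hl, by omega⟩, hkl⟩
    obtain ⟨p, hpR, hpq⟩ := hR.2 (k, l) hq
    exact (propTo_of_sameOrbit (hR.1 hpR) hq hpq).mem
      (Submodule.subset_span ⟨some ⟨p, hpR⟩, rfl⟩)

/-- **`V_N` is spanned by `x_π` and one Beta class per `S₃`-orbit.** -/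
theorem levelSpan_le {N : ℕ} (hN : 2 ≤ N) {R : Finset (ℕ × ℕ)} (hR : Represents N R) :
    levelSpan N ≤ Submodule.span K₀ (range (levelGens N R)) := by
  apply Submodule.span_le.mpr
  rintro x (rfl | ⟨k, l, m, n, hk, hkN, hl, hlN, rfl⟩)
  · exact Submodule.subset_span ⟨none, rfl⟩
  · have hN' : (0 : ℚ) < N := by exact_mod_cast (show 0 < N by omega)
    exact betaQ_shift_memSpan (div_pos (by exact_mod_cast hk) hN')
      (div_pos (by exact_mod_cast hl) hN') (betaQ_level_mem hN hR hk hkN hl hlN) m n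

/-- The generators lie in `V_N`. -/
theorem levelGens_mem {N : ℕ} {R : Finset (ℕ × ℕ)} (hR : Represents N R) (i : Option ↥R) :
    levelGens N R i ∈ levelSpan N := by
  rcases i with _ | ⟨⟨k, l⟩, hr⟩
  · exact Submodule.subset_span (mem_insert _ _)
  · have h := mem_levelPairs.mp (hR.1 hr)
    refine Submodule.subset_span (mem_insert_of_mem _ ⟨k, l, 0, 0, h.1.1, by omega, h.2.1.1,
      by omega, ?_⟩)
    simp [levelGens]

/-- Hence `V_N` IS the span of the generators. -/
theorem levelSpan_eq {N : ℕ} (hN : 2 ≤ N) {R : Finset (ℕ × ℕ)} (hR : Represents N R) :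
    levelSpan N = Submodule.span K₀ (range (levelGens N R)) :=
  le_antisymm (levelSpan_le hN hR) (Submodule.span_le.mpr (by
    rintro x ⟨i, rfl⟩; exact levelGens_mem hR i))

/-! ## Injectivity of the period map on `V_N` -/

/-- **The linear sector at level `N`.** If `π` and the Beta values `B(k/N, l/N)`, `(k,l) ∈ R`
(one per `S₃`-orbit), are linearly independent over `K₀ = ℚ̄ ∩ ℝ`, then the period map is
injective on `V_N`: every `K₀`-linear relation among level-`N` Beta words (and `π`) with
vanishing period is a consequence of the three Kontsevich–Zagier rules. For prime `N` the
hypothesis is the Wolfart–Wüstholz theorem. -/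
theorem kz_levelLinear {N : ℕ} (hN : 2 ≤ N) {R : Finset (ℕ × ℕ)} (hR : Represents N R)
    (h : LinearIndependent K₀ fun i => evalQ (levelGens N R i)) {z : Q} (hz : z ∈ levelSpan N)
    (h0 : evalQ z = 0) : z = 0 := by
  obtain ⟨c, rfl⟩ := (Submodule.mem_span_range_iff_exists_fun K₀).mp (levelSpan_le hN hR hz)
  have hsum : ∑ i, c i • evalQ (levelGens N R i) = 0 := by
    rw [map_sum] at h0
    simpa only [evalQ_smul, IntermediateField.smul_def, smul_eq_mul] using h0
  have hc : ∀ i, c i = 0 := Fintype.linearIndependent_iff.mp h c hsum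
  simp [hc]

/-- The period map is injective on `V_N` (same hypotheses). -/
theorem evalQ_injOn_levelSpan {N : ℕ} (hN : 2 ≤ N) {R : Finset (ℕ × ℕ)} (hR : Represents N R)
    (h : LinearIndependent K₀ fun i => evalQ (levelGens N R i)) : InjOn evalQ (levelSpan N) :=
  fun x hx y hy hxy => sub_eq_zero.mp
    (kz_levelLinear hN hR h ((levelSpan N).sub_mem hx hy) (by rw [map_sub, hxy, sub_self]))

/-! ## Levels 5, 6, 7 -/

/-- Orbit representatives at level 5: classes `A, B, C, D` of Deligne–Koblitz–Ogus. -/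
def reps5 : Finset (ℕ × ℕ) := {(1, 1), (1, 2), (4, 4), (3, 3)}

/-- `reps5` meets all four `S₃`-orbits at level 5. -/
theorem represents5 : Represents 5 reps5 := by decide

/-- Orbit representatives at level 6 (triples `{1,1,4}, {1,2,3}, {2,2,2}` and
`{2,5,5}, {3,4,5}, {4,4,4}`). -/
def reps6 : Finset (ℕ × ℕ) := {(1, 1), (1, 2), (2, 2), (5, 5), (4, 5), (4, 4)}

/-- `reps6` meets all six `S₃`-orbits at level 6. -/
theorem represents6 : Represents 6 reps6 := by decide

/-- Orbit representatives at level 7 (triples `{1,1,5}, {1,2,4}, {1,3,3}, {2,2,3}` and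
`{2,6,6}, {3,5,6}, {4,4,6}, {4,5,5}`). -/
def reps7 : Finset (ℕ × ℕ) := {(1, 1), (1, 2), (1, 3), (2, 2), (6, 6), (5, 6), (4, 6), (5, 5)}

/-- `reps7` meets all eight `S₃`-orbits at level 7. -/
theorem represents7 : Represents 7 reps7 := by decide

/-- **Level 5**: `V₅` is spanned by `x_π, β(1/5,1/5), β(1/5,2/5), β(4/5,4/5), β(3/5,3/5)` and the
period map is injective on it under Wolfart–Wüstholz linear independence (cf. `kz_fifthLinear`). -/
theorem kz_level5 (h : LinearIndependent K₀ fun i => evalQ (levelGens 5 reps5 i)) {z : Q}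
    (hz : z ∈ levelSpan 5) (h0 : evalQ z = 0) : z = 0 :=
  kz_levelLinear (by norm_num) represents5 h hz h0

/-- **Level 6, orbit form**: seven generators `x_π, β(1/6,1/6), β(1/6,1/3), β(1/3,1/3),
β(5/6,5/6), β(2/3,5/6), β(2/3,2/3)` span `V₆`. WARNING: these seven periods are linearly
DEPENDENT over `K₀` (duplication: `B(1/6,1/6) = 2^{4/3} sin(π/3) B(1/6,1/3)`), so this instance is
vacuous; the honest level-6 theorem is `kz_levelSix` in `SoloBlindLevelSix` (three generators). -/
theorem kz_level6 (h : LinearIndependent K₀ fun i => evalQ (levelGens 6 reps6 i)) {z : Q}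
    (hz : z ∈ levelSpan 6) (h0 : evalQ z = 0) : z = 0 :=
  kz_levelLinear (by norm_num) represents6 h hz h0

/-- **Level 7**: nine generators, `x_π` and eight Beta classes. -/
theorem kz_level7 (h : LinearIndependent K₀ fun i => evalQ (levelGens 7 reps7 i)) {z : Q}
    (hz : z ∈ levelSpan 7) (h0 : evalQ z = 0) : z = 0 :=
  kz_levelLinear (by norm_num) represents7 h hz h0

end SoloBlind

end Summit.KontsevichZagierPeriods.KontsevichZagierPeriods.Theorems
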